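import Literature.ModelTheory.PseudofiniteFields.TermDeterminant

/-!
# Stub SD1 of line LonelyTranslates (c1, stage D): determinants of matrices of ring terms

Crux `PairwiseCurvedTilingsLC` (route DefinableSTPPDichotomy, stmt-MatrixMultiplication-17883),
negative line LonelyTranslates, continuation c1 ("Prop27Reduction"), stage D (algebraic
boundedness of characteristic-`0` pseudo-finite fields from CDM Prop. 2.7 by compactness, which
needs "a standard smooth locus of bounded complexity" to be ONE ring formula in the coefficients,
hence Jacobian determinants of generic polynomials to be ring terms).  The registered stub
`stub_exists_term_realize_det`: the determinant of a square matrix of ring terms is realised by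
a ring term, uniformly in the field.  It is
`Literature.ModelTheory.PseudofiniteFields.exists_term_realize_det` (Leibniz expansion written
as a term).
-/

set_option linter.dupNamespace false  -- `Summit.<S>.<S>.…` is the mandated namespace

namespace Summit.MatrixMultiplication.MatrixMultiplication.Theorems.PairwiseCurvedTilingsLC.Negative

open FirstOrder FirstOrder.Language FirstOrder.Ring
open Literature.ModelTheory.PseudofiniteFields

/-- STUB (stage D, SD1): the determinant of a square matrix of ring terms is a ring term
(`exists_term_realize_det`, the Leibniz expansion as a term). -/
theorem stub_exists_term_realize_det {α ι : Type} [Fintype ι] [DecidableEq ι]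
    (M : ι → ι → Language.ring.Term α) :
    ∃ s : Language.ring.Term α, ∀ (K : Type) [Field K] [CompatibleRing K] (v : α → K),
      s.realize v = (Matrix.of fun i j => (M i j).realize v).det :=
  exists_term_realize_det M

end Summit.MatrixMultiplication.MatrixMultiplication.Theorems.PairwiseCurvedTilingsLC.Negative
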